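import Mathlib
import HarnessLib
import Summits.NavierStokesRegularity.NavierStokesRegularity.Theorems.AxisTwistDoorAveragedConeLiouvilleRescale

/-!
# Route `AxisTwistDoor`, crux `AveragedConeLiouville` (stmt-NavierStokesRegularity-26889), line `lrt_shell`, stub (5)
# `stub_fluxDecay` — brick F4: the split of the ONE-SCALE CONTRACTION into FLUID DATA (5a) and a PURE-PDE
# HARNACK CHAIN (5b), and their assembly `unitContraction_of`

Lei–Ren–Tian, arXiv:2501.08976, §4 pp. 11–12.  The one-scale contraction `UnitContraction` (brick F2) is the
conjunction of two independent pieces: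

* (5a) `ShellSupersolution` — FLUID → PDE DATA (size M, provable now from the landed toolkit / circle-swirl /
  Gamma-34 / CircMonotone bricks and the class-specialised `ShellFact`): for every class profile with the sign and the
  slack-free cone (constant `K`), the axis circulation `Γ = circ w` is `C²` on `s < 0`, non-negative and non-decreasing
  in `r`, bounded by `Γ*(K,C,I₀)` on `𝒬(1)`, small near the axis at early times (`Γ ≤ A r/√(−s)`, Type-I rate), and on
  a quantitative regular shell `a ∈ (2/3,4/5)`, `δ ∈ [δ₀,1/10]` it satisfies eq. Gamma-34
  `∂ₛΓ − ∂_z²Γ − ∂ᵣ²Γ + (r⁻¹ − C_d)∂ᵣΓ ≤ 0` on the lateral shell `{a−δ<r<a+δ}` up to `s → 0⁻` and on the early slab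
  `{r < a+δ, s < −(a−δ)²}`, all for `|z| < a+δ`, `−(a+δ)² < s < 0`;
* (5b) `AxisHarnackChain` — PURE PDE (size L; no fluid mechanics): for ANY function `Γ(r,z,s)` with these properties,
  a non-decay level `κ₀` met in every `𝒬(ρ)` and a bound `Γ ≤ M` on `𝒬(9/10)` improve to `Γ ≤ M − c` on `𝒬(9/20)`
  with `c = c(δ₀, C_d, A, κ₀) > 0`, GIVEN the classical positivity propagation `PositivityPropagationFactC`
  (LRT: `V = M − Γ` lifted to the axisymmetric function `V(t,x) = M − Γ(|x_h|, x₃, t)` is a non-negative supersolution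
  of `∂ₜ − Δ + ((1−C_d)/r) e_r·∇` on the shell and the early slab; `V ≥ κ₀/2` near the axis at early times; a Harnack
  chain of positivity-propagation cylinders through the early slab and forward along the shell; monotonicity in `r`);
* `unitContraction_of : ShellSupersolution → AxisHarnackChain → ShellFact → PositivityPropagationFactC →
  UnitContraction` (this file's theorem: `σ = min 1 (c / max Γ* κ₀)`, bound `min M Γ*`).

Seat ns-atd-p1 (LEAD). WHAT THIS IS NOT: not a statement about Navier–Stokes regularity; (5a) and (5b) are NOT proved
here (they are the registered stubs of the skeleton v6). Lands `--supports` the crux item as a helper.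
-/

noncomputable section

-- the summit and its single sub-problem share the name (CONVENTIONS §1), as in every Theorems file
set_option linter.dupNamespace false

namespace Summit.NavierStokesRegularity.NavierStokesRegularity.Theorems.AxisTwistDoorAveragedConeLiouvilleUnitContraction

open scoped InnerProductSpace ENNReal
open Set Function MeasureTheory Metric
open Literature.Analysis
open Literature.Analysis.FluidPDE hiding eR
open Summit.NavierStokesRegularity.NavierStokesRegularity.Theorems.AxisTwistDoorAveragedConeLiouvilleDefs
open Summit.NavierStokesRegularity.NavierStokesRegularity.Theorems.AxisTwistDoorAveragedConeLiouvilleFluxIteration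
open Summit.NavierStokesRegularity.NavierStokesRegularity.Theorems.AxisTwistDoorAveragedConeLiouvilleRescale

/-! ### The PDE data of an axis circulation -/

/-- The PDE DATA that the Harnack chain consumes, for a function `Γ(r,z,s)` (arguments in this order) and constants
`(δ₀, C_d, A, Γ*)`: (H1) `C²` in `(r,z,s)` on `s < 0`; (H2) `0 ≤ Γ` and `Γ` non-decreasing in `r ≥ 0`; (H3) `Γ ≤ Γ*`
on `𝒬(1) = {−1 < s < 0, 0 < r < 1, |z| < 1}`; (H4) early smallness near the axis `Γ(r,z,s) ≤ A r/√(−s)`; (H5) a shell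
`a ∈ (2/3,4/5)`, `δ ∈ [δ₀, 1/10]` with eq. Gamma-34 `∂ₛΓ − ∂_z²Γ − ∂ᵣ²Γ + (r⁻¹ − C_d)∂ᵣΓ ≤ 0` at every point of the
lateral shell `a−δ < r < a+δ` or of the early slab `s < −(a−δ)²`, within `0 < r < a+δ`, `|z| < a+δ`,
`−(a+δ)² < s < 0`. -/
def AxisCirculationData (Γ : ℝ → ℝ → ℝ → ℝ) (δ₀ Cd A Γstar : ℝ) : Prop :=
  ContDiffOn ℝ 2 (fun q : ℝ × ℝ × ℝ => Γ q.1 q.2.1 q.2.2) {q | q.2.2 < 0} ∧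
  (∀ s : ℝ, s < 0 → ∀ z r₁ r₂ : ℝ, 0 ≤ r₁ → r₁ ≤ r₂ → 0 ≤ Γ r₁ z s ∧ Γ r₁ z s ≤ Γ r₂ z s) ∧
  (∀ s r z : ℝ, -1 ^ 2 < s → s < 0 → 0 < r → r < 1 → |z| < 1 → Γ r z s ≤ Γstar) ∧
  (∀ s : ℝ, s < 0 → ∀ r : ℝ, 0 ≤ r → ∀ z : ℝ, Γ r z s ≤ A * r / Real.sqrt (-s)) ∧
  ∃ a δ : ℝ, 2 / 3 < a ∧ a < 4 / 5 ∧ δ₀ ≤ δ ∧ δ ≤ 1 / 10 ∧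
    ∀ s r z : ℝ, -(a + δ) ^ 2 < s → s < 0 → 0 < r → r < a + δ → |z| < a + δ →
      (a - δ < r ∨ s < -(a - δ) ^ 2) →
      deriv (fun s' => Γ r z s') s
        - deriv (fun z' => deriv (fun z'' => Γ r z'' s) z') z
        - deriv (fun r' => deriv (fun r'' => Γ r'' z s) r') r
        + (r⁻¹ - Cd) * deriv (fun r' => Γ r' z s) r ≤ 0

/-- STUB (5a) statement — FLUID → PDE DATA: given the class-specialised shell fact, for constants `(K, C, I₀)` there are
`δ₀ > 0`, `C_d, A, Γ* ≥ 0` such that the axis circulation of every class profile with Type-I constant `C`, `𝐈 ≤ I₀`,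
the sign and the slack-free cone with constant `K` carries `AxisCirculationData (circ w) δ₀ C_d A Γ*`. -/
def ShellSupersolution : Prop :=
  ShellFact → ∀ (K C : ℝ) (I₀ : ℝ≥0∞), 0 ≤ K → I₀ < ⊤ →
    ∃ δ₀ Cd A Γstar : ℝ, 0 < δ₀ ∧ 0 ≤ Cd ∧ 0 ≤ A ∧ 0 ≤ Γstar ∧
      ∀ (w : ℝ → EuclideanSpace ℝ (Fin 3) → EuclideanSpace ℝ (Fin 3)) (ϖ : ℝ → EuclideanSpace ℝ (Fin 3) → ℝ)
        (G : ℝ → EuclideanSpace ℝ (Fin 3) → EuclideanSpace ℝ (Fin 3) →L[ℝ] EuclideanSpace ℝ (Fin 3)),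
        InClass C w ϖ G → typeIBound (Iio (0 : ℝ) ×ˢ univ) w ϖ G ≤ I₀ → SignE3 w →
        (∀ s : ℝ, s < 0 → ∀ r : ℝ, 0 < r → ∀ z : ℝ, tiltCirc w r z s ≤ K * vortCirc w r z s) →
        AxisCirculationData (circ w) δ₀ Cd A Γstar

/-- STUB (5b) statement — the PURE-PDE HARNACK CHAIN (LRT pp. 11–12): given the classical positivity propagation, for
constants `δ₀ > 0`, `C_d, A ≥ 0`, `κ₀ > 0` there is `c > 0` such that every `Γ` with `AxisCirculationData Γ δ₀ C_d A Γ*`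
(any `Γ*`), the level `κ₀` met in every `𝒬(ρ)`, and `Γ ≤ M` on `𝒬(9/10)` satisfies `Γ ≤ M − c` on `𝒬(9/20)`. -/
def AxisHarnackChain : Prop :=
  PositivityPropagationFactC → ∀ (δ₀ Cd A κ₀ : ℝ), 0 < δ₀ → 0 ≤ Cd → 0 ≤ A → 0 < κ₀ →
    ∃ c : ℝ, 0 < c ∧ ∀ (Γ : ℝ → ℝ → ℝ → ℝ) (Γstar M : ℝ), AxisCirculationData Γ δ₀ Cd A Γstar →
      (∀ ρ : ℝ, 0 < ρ → ∃ s r z : ℝ, -ρ ^ 2 < s ∧ s < 0 ∧ 0 < r ∧ r < ρ ∧ |z| < ρ ∧ κ₀ ≤ Γ r z s) →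
      (∀ s r z : ℝ, -(9 / 10) ^ 2 < s → s < 0 → 0 < r → r < 9 / 10 → |z| < 9 / 10 → Γ r z s ≤ M) →
      ∀ s r z : ℝ, -(9 / 20) ^ 2 < s → s < 0 → 0 < r → r < 9 / 20 → |z| < 9 / 20 → Γ r z s ≤ M - c

/-! ### Assembly -/

/-- **Brick F4 — the one-scale contraction from (5a) and (5b).**  With `Γ*` from the fluid data and `c` from the
chain, `σ := min 1 (c / max Γ* κ₀)`: a bound `M` on `𝒬(9/10)` may be replaced by `min M Γ*`, which the level forces
to be `≥ κ₀`; the chain gives `Γ ≤ min M Γ* − c ≤ (1 − σ) M` on `𝒬(9/20)`. -/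
theorem unitContraction_of (h5a : ShellSupersolution) (h5b : AxisHarnackChain) (hShell : ShellFact)
    (hPos : PositivityPropagationFactC) : UnitContraction := by
  intro K C I₀ κ₀ hK hI₀ hκ₀
  obtain ⟨δ₀, Cd, A, Γstar, hδ₀, hCd, hA, hΓstar, hdata⟩ := h5a hShell K C I₀ hK hI₀
  obtain ⟨c, hc, hchain⟩ := h5b hPos δ₀ Cd A κ₀ hδ₀ hCd hA hκ₀
  set L : ℝ := max Γstar κ₀ with hL
  have hLpos : 0 < L := lt_of_lt_of_le hκ₀ (le_max_right _ _)
  refine ⟨min 1 (c / L), Γstar, lt_min one_pos (div_pos hc hLpos), min_le_left _ _, ?_⟩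
  intro w ϖ G hcl hI hsign hcone hlev
  have hD := hdata w ϖ G hcl hI hsign hcone
  -- (H3): the bound on `𝒬(1)` gives the bound on `𝒬(9/10)`
  have hbound : CircBoundOn w (9 / 10) Γstar := by
    have h1 : CircBoundOn w 1 Γstar := fun s r z hs hs0 hr hr1 hz => hD.2.2.1 s r z hs hs0 hr hr1 hz
    exact circBoundOn_mono w (by norm_num) (by norm_num) h1
  refine ⟨hbound, fun M hM => ?_⟩
  -- replace `M` by `M' = min M Γ*`
  set M' : ℝ := min M Γstar with hM'
  have hM'b : CircBoundOn w (9 / 10) M' := fun s r z hs hs0 hr hr1 hz =>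
    le_min (hM s r z hs hs0 hr hr1 hz) (hbound s r z hs hs0 hr hr1 hz)
  -- the level forces `κ₀ ≤ M'`, hence `M' ≤ L` is the relevant range
  have hκM : κ₀ ≤ M' := by
    obtain ⟨s, r, z, hs, hs0, hr, hrρ, hz, hge⟩ := hlev (9 / 10) (by norm_num)
    exact hge.trans (hM'b s r z hs hs0 hr hrρ hz)
  have hM'L : M' ≤ L := (min_le_right _ _).trans (le_max_left _ _)
  -- the chain
  have hch := hchain (circ w) Γstar M' hD hlev hM'b
  intro s r z hs hs0 hr hrρ hz
  have h1 : circ w r z s ≤ M' - c :=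
    hch s r z (by nlinarith) hs0 hr (by linarith) (by linarith)
  -- `M' − c ≤ (1 − σ) M'  ≤ (1 − σ) M`
  have hσ : min 1 (c / L) * M' ≤ c := by
    have h2 : min 1 (c / L) * M' ≤ (c / L) * M' :=
      mul_le_mul_of_nonneg_right (min_le_right _ _) (le_trans hκ₀.le hκM)
    have h3 : (c / L) * M' ≤ (c / L) * L := mul_le_mul_of_nonneg_left hM'L (div_nonneg hc.le hLpos.le)
    have h4 : (c / L) * L = c := div_mul_cancel₀ c hLpos.ne'
    linarith
  have hσ1 : min 1 (c / L) ≤ 1 := min_le_left _ _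
  have hMM : M' ≤ M := min_le_left _ _
  have h5 : (1 - min 1 (c / L)) * M' ≤ (1 - min 1 (c / L)) * M :=
    mul_le_mul_of_nonneg_left hMM (by linarith)
  nlinarith

end Summit.NavierStokesRegularity.NavierStokesRegularity.Theorems.AxisTwistDoorAveragedConeLiouvilleUnitContraction

end
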